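import Summits.QuantumFields.BalabanUV.Beta.GAN24.ForceSourceFeedback

/-!
# `BalabanUV.Beta.GAN24.ScaledPartFF` — binder row G-an2-4 / (CONV-C), road P1-fibre, leaf **P1-L09** `FibreUniformBound`, part **H1** (b):
# the FIELD–FIELD scaled part `s_f(j)² · Σ_m ‖readW(m,κ,x′)‖·‖Â_κ(m)[force source (l,y′)]‖` is bounded N-UNIFORMLY at `d = 3` (`D = 4`)

NOT IN PRINT; OUR PROOF ATTEMPT.  HONEST FRAMING (cell contract, verbatim): «discharging `BetaPertH` makes Bałaban's UV stability UNCONDITIONAL — a real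
constructive-QFT result; it is NOT the continuum limit and NOT the Clay problem.»  HONEST DEPENDENCY (verbatim): «continuum YM on T⁴ ⇐ BetaPertH ∧ nine spine
estimates (0/9 proved); BetaPertH ⇐ (D1) ∧ (D4) ∧ CAP+tail; G-an2-4 gates asym, D1 and NE2/3/4.»  [folklore] bookkeeping over LANDED inputs BY NAME: typer row P1-Y09a
(`FieldBlockResponse.norm_Ahat_le_param`, `norm_Ahat_le_of_QRows_of_bound`), P1-Y09b (`ReadingWeightSums.offZero_sum_le`, `norm_readW_le_one`), my lineage's P1-Y09x
(`ReadingWeightCrossSums`), leaf-12's zero-alias weight bound (`CapacitanceScalarBounds.sq_le_gNormSq_zero`), leaf-20's L08 endpoint through `ForceSourceFeedback`;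
no new estimate idea, no cited fact, no wall binder, no `def … : Prop`; one explicit-constant `def` (`xFF`).  NOT summit progress; nothing of (CONV-C)'s K-slot
`GAN24.CombesThomas.ConvCK 3 Lc` is discharged here; 0 wall binders instantiated; NOT `BetaPertH`, NOT continuum, NOT Clay.

## What is proved (`q ∈ [−π, π]^D ∖ {0}`, `p = ofRealVec q`, `0 < M ≤ N`, `f̂ = fhatF N M p l y′`, `ĉ = 0`, `r = N/M`, `C = aliasWtConst D`)
* §1 `pow_le_norm_SAl_mul_sAl_zero`: `(2N/π)^{D+1} ≤ ‖S(0)‖·‖s_κ(0)‖` (the Q-row pins the zero alias with an `N^{D+1}` weight).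
* §2 `norm_Ahat_fhatF_le`: for every class `m`, `‖Â_κ(m)‖ ≤ α(m) := √D(‖srcW(m)‖ + ‖χ̂(m)‖·N·Bφ)/(2‖L_m‖) + ‖χ̂(m)‖·Bc/(‖L_m‖√‖L_m‖)` under the feedback
  hypotheses `‖φ_κ‖ ≤ Bφ`, `‖c‖ ≤ Bc` (Y09a with `F_m = ‖srcW(m)‖`, `S_m = N`).
* §3 `offZero_weighted_alpha_le`: for any weights `u`, `Σ_{m≠0} u(m)·α(m) ≤ (√D/2)(N²/N^D)·A₁ + (√D·N·Bφ/2)·N²·A₂ + Bc·N³·A₃` in terms of the three engine sums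
  of `u` against `‖N^D srcW‖/(N²lapR)`, `‖χ̂‖/(N²lapR)`, `‖χ̂‖/((N²lapR)^{3/2})`; instances `u = ‖readW(·,κ,x′)‖` (`offZero_readW_alpha_le`) and `u = ‖S‖‖s_κ‖`
  (`offZero_SsAl_alpha_le`).
* §4 `norm_Ahat_fhatF_zero_le`: the ZERO CLASS by the Q rows (Y09a §4(b), `ĉ = 0`): `‖Â_κ(0)‖ ≤ (π/2)^{D+1}·[(√D/2)(N²/N^D) r^{D+1}C + (√D/2)N³Bφ C + Bc N³ C/2]` — no `1/L_0`.
* §5 **`pow_mul_sum_readW_Ahat_le`**: `N^D · Σ_m ‖readW(m,κ,x′)‖·‖Â_κ(m)‖ ≤ N² · xFF D r` with the feedback of `ForceSourceFeedback` inserted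
  (`N^{D+1}Bφ ≤ bPhi0 D r (Dπ²)`, `N^{D+1}Bc ≤ bC0 D r (Dπ²)`), `xFF` explicit.
* §6 **`scaledFF_three`** (`d = 3`, `N = Lc^{j+1}`, `M = Lc^j`, `s_f(j) = sfStep Lc j = Lc^j`): for every `j`, `q ∈ [−π,π]⁴ ∖ {0}`, `κ l x′ y′`:
  `sfStep Lc j ^ 2 · Σ_m ‖readW‖·‖Â‖ ≤ xFF 4 Lc / Lc²` — the units close EXACTLY at `D = 4` (`M²·N²/N⁴ = Lc⁻²`); this is the body of leaf-05's hypothesis shape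
  `FibreUniformBound.ScaledFF (d := 3) Lc (sfStep Lc) (xFF 4 Lc / Lc²)`; `scaledFF_three_of_mem_BZ` takes `q ∈ BZ (3+1)` literally, so the L09 assembly's `h₁` is a λ over it.
Unit `b2b-balaban-gan24-formalise-leaf-03` (G-an2-4 formalisation swarm, leaf prover 03, gen 6), 2026-08-20.
-/

noncomputable section

open Complex Finset
open scoped BigOperators Real ComplexConjugate

namespace Summit.QuantumFields.BalabanUV.Beta.GAN24.ScaledPartFF

open Literature.Probability.LatticeModels (TorusSite)
open Literature.MathematicalPhysics.QuantumFieldTheory.Balaban1983to89.B4Strip (ofRealVec)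
open Literature.MathematicalPhysics.QuantumFieldTheory.Balaban1983to89.B4ContourShift (BZ)
open Literature.MathematicalPhysics.QuantumFieldTheory.King1986 (momSq momSq_nonneg momSq_le_card_mul_pi_sq)
open AliasWeights (sinWt kfine)
open AliasWeightsSum (lapR lapR_nonneg aliasWtConst)
open AliasObjects (SAl sAl sbAl chiAl LAl cap srcW readW phiSol cSol Ahat fhatF conj_ofRealVec)
open CapacitanceScalarBounds (gNormSq gNormSq_nonneg sq_le_gNormSq_zero momSq_pos)
open CapacitanceScalarDictionary (normSq_SAl norm_sq_sAl LAl_ofRealVec_ne_zero)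
open ReadingWeightSums (norm_readW_le_one offZero_sum_le)
open ReadingWeightCrossSums (norm_LAl_ofRealVec norm_LAl_mul_sqrt_eq norm_sbAl_eq offZero_readW_chiAl_sum_le offZero_readW_chiAl_sum_three_halves_le
  offZero_SsAl_srcW_sum_le offZero_SsAl_chiAl_sum_le offZero_SsAl_chiAl_sum_three_halves_le)
open CapacitanceEndpoint (isUnit_cap_det_ofRealVec)
open CombesThomas (sfStep)
open ForceSourceBounds (norm_fhatF_le norm_sAl_le norm_srcW_eq sum_eq_zero_add_sum_erase)
open CapacitanceEndpointBlocks (aliasWtConst_nonneg)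
open ForceSourceFeedback (bPhi0 bC0 bPhi0_nonneg bC0_nonneg norm_phiSol_fhatF_le' norm_cSol_fhatF_le')

variable {D N : ℕ} [NeZero N]

/-! ## §1 The zero alias carries an `N^{D+1}` Q-row weight -/

/-- [folklore] `(2N/π)^{D+1} ≤ ‖S(0)‖·‖s_κ(0)‖` on `[−π, π]^D`, `N ≥ 1` (leaf-12's `sq_le_gNormSq_zero` in every coordinate). -/
theorem pow_le_norm_SAl_mul_sAl_zero (hN : 1 ≤ N) {q : Fin D → ℝ} (hq : ∀ i, |q i| ≤ π) (κ : Fin D) :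
    (2 / π * N) ^ (D + 1) ≤ ‖SAl N (ofRealVec q) 0‖ * ‖sAl N (ofRealVec q) 0 κ‖ := by
  have hπ := Real.pi_pos
  have hcoord : ∀ i, 4 / π ^ 2 * (N : ℝ) ^ 2 ≤ gNormSq N (kfine N q 0 i) := fun i => by
    rw [CapacitanceScalarBounds.kfine_zero]; exact sq_le_gNormSq_zero hN (hq i)
  have hsq : ((2 / π * N) ^ (D + 1)) ^ 2 ≤ (‖SAl N (ofRealVec q) 0‖ * ‖sAl N (ofRealVec q) 0 κ‖) ^ 2 := by
    calc ((2 / π * N) ^ (D + 1)) ^ 2 = (4 / π ^ 2 * (N : ℝ) ^ 2) ^ D * (4 / π ^ 2 * (N : ℝ) ^ 2) := by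
          rw [← pow_mul, mul_comm (D + 1) 2, pow_mul, pow_succ]
          congr 2 <;> ring
      _ = (∏ _i : Fin D, (4 / π ^ 2 * (N : ℝ) ^ 2)) * (4 / π ^ 2 * (N : ℝ) ^ 2) := by
          rw [Finset.prod_const, Finset.card_univ, Fintype.card_fin]
      _ ≤ (∏ i, gNormSq N (kfine N q 0 i)) * gNormSq N (kfine N q 0 κ) :=
          mul_le_mul (Finset.prod_le_prod (fun i _ => by positivity) fun i _ => hcoord i) (hcoord κ) (by positivity)
            (Finset.prod_nonneg fun i _ => gNormSq_nonneg _ _)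
      _ = (‖SAl N (ofRealVec q) 0‖ * ‖sAl N (ofRealVec q) 0 κ‖) ^ 2 := by
          rw [mul_pow, ← Complex.normSq_eq_norm_sq, normSq_SAl, norm_sq_sAl]
  exact (pow_le_pow_iff_left₀ (by positivity) (by positivity) two_ne_zero).1 hsq

/-- [folklore] Hence `S(0)·s_κ(0) ≠ 0`. -/
theorem SAl_mul_sAl_zero_ne_zero (hN : 1 ≤ N) {q : Fin D → ℝ} (hq : ∀ i, |q i| ≤ π) (κ : Fin D) :
    SAl N (ofRealVec q) 0 * sAl N (ofRealVec q) 0 κ ≠ 0 := by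
  have hNr : (0 : ℝ) < N := by exact_mod_cast hN
  have h := pow_le_norm_SAl_mul_sAl_zero hN hq κ
  have hpos : 0 < (2 / π * (N : ℝ)) ^ (D + 1) := by positivity
  rw [← norm_ne_zero_iff, norm_mul]
  exact (lt_of_lt_of_le hpos h).ne'

/-! ## §2 The generic-class response bound for the force source -/

section Generic

variable {M : ℕ} (hN : 1 ≤ N) {q : Fin D → ℝ} (hq : ∀ i, |q i| ≤ π) (hq0 : q ≠ 0) (l : Fin D) (y' : Fin D → ℤ) {Bφ Bc : ℝ}
  (hφ : ∀ κ, ‖phiSol N (ofRealVec q) (fhatF N M (ofRealVec q) l y') 0 κ‖ ≤ Bφ)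
  (hc : ‖cSol N (ofRealVec q) (fhatF N M (ofRealVec q) l y') 0‖ ≤ Bc)
include hN hq hq0 hφ hc

/-- [folklore] **RESPONSE OF CLASS `m` TO THE FORCE SOURCE** (typer row P1-Y09a `norm_Ahat_le_param` with `F_m = ‖srcW(m)‖`, `S_m = N`):
`‖Â_κ(m)‖ ≤ α(m) := √D·(‖srcW(m)‖ + ‖χ̂(m)‖·N·Bφ)/(2‖L_m‖) + ‖χ̂(m)‖·Bc/(‖L_m‖√‖L_m‖)`. -/
theorem norm_Ahat_fhatF_le (m : TorusSite D N) (κ : Fin D) :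
    ‖Ahat N (ofRealVec q) (fhatF N M (ofRealVec q) l y') 0 m κ‖
      ≤ Real.sqrt D * (‖srcW N M (ofRealVec q) m l y'‖ + ‖chiAl N (ofRealVec q) m‖ * N * Bφ) / (2 * ‖LAl N (ofRealVec q) m‖)
        + ‖chiAl N (ofRealVec q) m‖ * Bc / (‖LAl N (ofRealVec q) m‖ * Real.sqrt ‖LAl N (ofRealVec q) m‖) :=
  FieldBlockResponse.norm_Ahat_le_param (conj_ofRealVec q) (LAl_ofRealVec_ne_zero hN hq hq0 m) _ _
    (fun l' => norm_fhatF_le M _ l y' m l') (fun l' => (norm_sbAl_eq q m l').le.trans (norm_sAl_le q m l')) hφ hc κ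

/-! ## §3 Weighted off-zero sums of `α(m)` -/

/-- [folklore] **WEIGHTED OFF-ZERO SUM OF `α`**: for weights `u` whose three engine sums are bounded by `A₁, A₂, A₃`,
`Σ_{m≠0} u(m)·α(m) ≤ (√D/2)·(N²/N^D)·A₁ + (√D·N·Bφ/2)·N²·A₂ + Bc·N³·A₃` (conversions `1/‖L_m‖ = N²/(N²lapR)`, `‖srcW‖ = ‖N^D srcW‖/N^D`, `3/2` form). -/
theorem offZero_weighted_alpha_le {u : TorusSite D N → ℝ} {A₁ A₂ A₃ : ℝ}
    (h₁ : ∑ m ∈ (Finset.univ : Finset (TorusSite D N)).erase 0,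
        u m * ‖(N : ℂ) ^ D * srcW N M (ofRealVec q) m l y'‖ / ((N : ℝ) ^ 2 * lapR (kfine N q m)) ≤ A₁)
    (h₂ : ∑ m ∈ (Finset.univ : Finset (TorusSite D N)).erase 0, u m * ‖chiAl N (ofRealVec q) m‖ / ((N : ℝ) ^ 2 * lapR (kfine N q m)) ≤ A₂)
    (h₃ : ∑ m ∈ (Finset.univ : Finset (TorusSite D N)).erase 0,
        u m * ‖chiAl N (ofRealVec q) m‖ / (((N : ℝ) ^ 2 * lapR (kfine N q m)) * Real.sqrt ((N : ℝ) ^ 2 * lapR (kfine N q m))) ≤ A₃) :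
    ∑ m ∈ (Finset.univ : Finset (TorusSite D N)).erase 0,
        u m * (Real.sqrt D * (‖srcW N M (ofRealVec q) m l y'‖ + ‖chiAl N (ofRealVec q) m‖ * N * Bφ) / (2 * ‖LAl N (ofRealVec q) m‖)
          + ‖chiAl N (ofRealVec q) m‖ * Bc / (‖LAl N (ofRealVec q) m‖ * Real.sqrt ‖LAl N (ofRealVec q) m‖))
      ≤ Real.sqrt D / 2 * ((N : ℝ) ^ 2 / (N : ℝ) ^ D) * A₁ + Real.sqrt D * N * Bφ / 2 * (N : ℝ) ^ 2 * A₂ + Bc * (N : ℝ) ^ 3 * A₃ := by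
  have hNr : (0 : ℝ) < N := by exact_mod_cast hN
  have hL := LAl_ofRealVec_ne_zero hN hq hq0 (N := N)
  have hBφ : 0 ≤ Bφ := (norm_nonneg _).trans (hφ l)
  have hBc : 0 ≤ Bc := (norm_nonneg _).trans hc
  -- termwise identity
  have e : ∀ m ∈ (Finset.univ : Finset (TorusSite D N)).erase 0,
      u m * (Real.sqrt D * (‖srcW N M (ofRealVec q) m l y'‖ + ‖chiAl N (ofRealVec q) m‖ * N * Bφ) / (2 * ‖LAl N (ofRealVec q) m‖)
          + ‖chiAl N (ofRealVec q) m‖ * Bc / (‖LAl N (ofRealVec q) m‖ * Real.sqrt ‖LAl N (ofRealVec q) m‖))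
        = Real.sqrt D / 2 * ((N : ℝ) ^ 2 / (N : ℝ) ^ D) *
            (u m * ‖(N : ℂ) ^ D * srcW N M (ofRealVec q) m l y'‖ / ((N : ℝ) ^ 2 * lapR (kfine N q m)))
          + Real.sqrt D * N * Bφ / 2 * (N : ℝ) ^ 2 * (u m * ‖chiAl N (ofRealVec q) m‖ / ((N : ℝ) ^ 2 * lapR (kfine N q m)))
          + Bc * (N : ℝ) ^ 3 *
            (u m * ‖chiAl N (ofRealVec q) m‖ / (((N : ℝ) ^ 2 * lapR (kfine N q m)) * Real.sqrt ((N : ℝ) ^ 2 * lapR (kfine N q m)))) := by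
    intro m _
    have hLm : 0 < lapR (kfine N q m) := by
      have := norm_pos_iff.2 (hL m); rwa [norm_LAl_ofRealVec] at this
    have hsq : 0 < Real.sqrt ((N : ℝ) ^ 2 * lapR (kfine N q m)) := Real.sqrt_pos.2 (by positivity)
    rw [norm_srcW_eq, norm_LAl_mul_sqrt_eq, norm_LAl_ofRealVec]
    field_simp
  rw [Finset.sum_congr rfl e, Finset.sum_add_distrib, Finset.sum_add_distrib, ← Finset.mul_sum, ← Finset.mul_sum, ← Finset.mul_sum]
  have c₁ : 0 ≤ Real.sqrt D / 2 * ((N : ℝ) ^ 2 / (N : ℝ) ^ D) := by positivity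
  have c₂ : 0 ≤ Real.sqrt D * N * Bφ / 2 * (N : ℝ) ^ 2 := by positivity
  have c₃ : 0 ≤ Bc * (N : ℝ) ^ 3 := by positivity
  exact add_le_add (add_le_add (mul_le_mul_of_nonneg_left h₁ c₁) (mul_le_mul_of_nonneg_left h₂ c₂)) (mul_le_mul_of_nonneg_left h₃ c₃)

variable (hM : 0 < M) (hMN : M ≤ N)
include hM hMN

/-- [folklore] **READING-WEIGHTED RESPONSE SUM** (`u = ‖readW(m, κ, x′)‖`; Y09b `offZero_sum_le` + Y09x G2 sums):
`Σ_{m≠0} ‖readW(m,κ,x′)‖·α(m) ≤ (√D/2)(N²/N^D)(r²)^D C + (√D N Bφ/2) N² r^{D+1} C + Bc N³ r^{D+1} C/2`. -/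
theorem offZero_readW_alpha_le (κ : Fin D) (x' : Fin D → ℤ) :
    ∑ m ∈ (Finset.univ : Finset (TorusSite D N)).erase 0,
        ‖readW N M (ofRealVec q) m κ x'‖ *
          (Real.sqrt D * (‖srcW N M (ofRealVec q) m l y'‖ + ‖chiAl N (ofRealVec q) m‖ * N * Bφ) / (2 * ‖LAl N (ofRealVec q) m‖)
            + ‖chiAl N (ofRealVec q) m‖ * Bc / (‖LAl N (ofRealVec q) m‖ * Real.sqrt ‖LAl N (ofRealVec q) m‖))
      ≤ Real.sqrt D / 2 * ((N : ℝ) ^ 2 / (N : ℝ) ^ D) * ((((N : ℝ) / M) ^ 2) ^ D * aliasWtConst D)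
        + Real.sqrt D * N * Bφ / 2 * (N : ℝ) ^ 2 * (((N : ℝ) / M) ^ (D + 1) * aliasWtConst D)
        + Bc * (N : ℝ) ^ 3 * (((N : ℝ) / M) ^ (D + 1) * aliasWtConst D / 2) :=
  offZero_weighted_alpha_le hN hq hq0 l y' hφ hc (offZero_sum_le hM hMN hq κ l x' y')
    (offZero_readW_chiAl_sum_le hM hMN hq κ x') (offZero_readW_chiAl_sum_three_halves_le hM hMN hq κ x')

/-- [folklore] **Q-ROW-WEIGHTED RESPONSE SUM** (`u = ‖S(m)‖·‖s_κ(m)‖`; Y09x G3b sums):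
`Σ_{m≠0} ‖S(m)‖‖s_κ(m)‖·α(m) ≤ (√D/2)(N²/N^D) N^{D+1} r^{D+1} C + (√D N Bφ/2) N² N^{D+1} C + Bc N³ N^{D+1} C/2`. -/
theorem offZero_SsAl_alpha_le (κ : Fin D) :
    ∑ m ∈ (Finset.univ : Finset (TorusSite D N)).erase 0,
        (‖SAl N (ofRealVec q) m‖ * ‖sAl N (ofRealVec q) m κ‖) *
          (Real.sqrt D * (‖srcW N M (ofRealVec q) m l y'‖ + ‖chiAl N (ofRealVec q) m‖ * N * Bφ) / (2 * ‖LAl N (ofRealVec q) m‖)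
            + ‖chiAl N (ofRealVec q) m‖ * Bc / (‖LAl N (ofRealVec q) m‖ * Real.sqrt ‖LAl N (ofRealVec q) m‖))
      ≤ Real.sqrt D / 2 * ((N : ℝ) ^ 2 / (N : ℝ) ^ D) * ((N : ℝ) ^ (D + 1) * ((N : ℝ) / M) ^ (D + 1) * aliasWtConst D)
        + Real.sqrt D * N * Bφ / 2 * (N : ℝ) ^ 2 * ((N : ℝ) ^ (D + 1) * aliasWtConst D)
        + Bc * (N : ℝ) ^ 3 * ((N : ℝ) ^ (D + 1) * aliasWtConst D / 2) :=
  offZero_weighted_alpha_le hN hq hq0 l y' hφ hc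
    (offZero_SsAl_srcW_sum_le hM hMN hq κ l y') (offZero_SsAl_chiAl_sum_le hq κ) (offZero_SsAl_chiAl_sum_three_halves_le hq κ)

/-! ## §4 The zero class by the Q rows (no `1/L_0`) -/

/-- [folklore] **ZERO-CLASS RESPONSE TO THE FORCE SOURCE** (Y09a `norm_Ahat_le_of_QRows_of_bound` with `ĉ = 0`, `α` of §2 for the other classes, the
`(2N/π)^{D+1}` weight of §1): `‖Â_κ(0)‖ ≤ (π/2)^{D+1}·[(√D/2)(N²/N^D) r^{D+1} C + (√D/2) N³ Bφ C + Bc N³ C/2]`. -/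
theorem norm_Ahat_fhatF_zero_le (κ : Fin D) :
    ‖Ahat N (ofRealVec q) (fhatF N M (ofRealVec q) l y') 0 0 κ‖
      ≤ (π / 2) ^ (D + 1) * (Real.sqrt D / 2 * ((N : ℝ) ^ 2 / (N : ℝ) ^ D) * (((N : ℝ) / M) ^ (D + 1) * aliasWtConst D)
          + Real.sqrt D / 2 * (N : ℝ) ^ 3 * Bφ * aliasWtConst D + Bc * (N : ℝ) ^ 3 * (aliasWtConst D / 2)) := by
  have hNr : (0 : ℝ) < N := by exact_mod_cast hN
  have hπ := Real.pi_pos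
  have hL := LAl_ofRealVec_ne_zero hN hq hq0 (N := N)
  have h0 := SAl_mul_sAl_zero_ne_zero hN hq κ (N := N)
  have hw := pow_le_norm_SAl_mul_sAl_zero hN hq κ (N := N)
  have hwpos : 0 < (2 / π * (N : ℝ)) ^ (D + 1) := by positivity
  have hQ := FieldBlockResponse.norm_Ahat_le_of_QRows_of_bound (ofRealVec q) hL (isUnit_cap_det_ofRealVec hN hq hq0)
    (fhatF N M (ofRealVec q) l y') 0 κ h0 (fun m _ => norm_Ahat_fhatF_le hN hq hq0 l y' hφ hc m κ)
  have hT := offZero_SsAl_alpha_le hN hq hq0 l y' hφ hc hM hMN κ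
  rw [Pi.zero_apply, norm_zero, zero_add, norm_mul] at hQ
  -- replace `‖S(m)·s_κ(m)‖` by `‖S(m)‖·‖s_κ(m)‖` in the numerator
  simp only [norm_mul] at hQ
  have hT0 : 0 ≤ ∑ m ∈ (Finset.univ : Finset (TorusSite D N)).erase 0,
      (‖SAl N (ofRealVec q) m‖ * ‖sAl N (ofRealVec q) m κ‖) *
        (Real.sqrt D * (‖srcW N M (ofRealVec q) m l y'‖ + ‖chiAl N (ofRealVec q) m‖ * N * Bφ) / (2 * ‖LAl N (ofRealVec q) m‖)
          + ‖chiAl N (ofRealVec q) m‖ * Bc / (‖LAl N (ofRealVec q) m‖ * Real.sqrt ‖LAl N (ofRealVec q) m‖)) :=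
    Finset.sum_nonneg fun m _ => mul_nonneg (mul_nonneg (norm_nonneg _) (norm_nonneg _))
      ((norm_nonneg _).trans (norm_Ahat_fhatF_le hN hq hq0 l y' hφ hc m κ))
  refine hQ.trans ((div_le_div_of_nonneg_left hT0 hwpos hw).trans ?_)
  rw [div_le_iff₀ hwpos]
  refine hT.trans (le_of_eq ?_)
  have e : (π / 2) ^ (D + 1) * (2 / π * (N : ℝ)) ^ (D + 1) = (N : ℝ) ^ (D + 1) := by
    rw [← mul_pow]; congr 1; field_simp
  calc Real.sqrt D / 2 * ((N : ℝ) ^ 2 / (N : ℝ) ^ D) * ((N : ℝ) ^ (D + 1) * ((N : ℝ) / M) ^ (D + 1) * aliasWtConst D)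
        + Real.sqrt D * N * Bφ / 2 * (N : ℝ) ^ 2 * ((N : ℝ) ^ (D + 1) * aliasWtConst D)
        + Bc * (N : ℝ) ^ 3 * ((N : ℝ) ^ (D + 1) * aliasWtConst D / 2)
      = (Real.sqrt D / 2 * ((N : ℝ) ^ 2 / (N : ℝ) ^ D) * (((N : ℝ) / M) ^ (D + 1) * aliasWtConst D)
          + Real.sqrt D / 2 * (N : ℝ) ^ 3 * Bφ * aliasWtConst D + Bc * (N : ℝ) ^ 3 * (aliasWtConst D / 2)) * (N : ℝ) ^ (D + 1) := by ring
    _ = _ := by rw [← e]; ring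

/-! ## §5 The whole reading sum under the feedback hypotheses, and with the feedback inserted -/

/-- [folklore] **THE FIELD–FIELD READING SUM, PARAMETER FORM**: `Σ_m ‖readW(m,κ,x′)‖·‖Â_κ(m)‖ ≤` (zero class, `‖readW(0)‖ ≤ 1`) `+` (off-zero sum). -/
theorem sum_readW_Ahat_le_param (κ : Fin D) (x' : Fin D → ℤ) :
    ∑ m, ‖readW N M (ofRealVec q) m κ x'‖ * ‖Ahat N (ofRealVec q) (fhatF N M (ofRealVec q) l y') 0 m κ‖
      ≤ (π / 2) ^ (D + 1) * (Real.sqrt D / 2 * ((N : ℝ) ^ 2 / (N : ℝ) ^ D) * (((N : ℝ) / M) ^ (D + 1) * aliasWtConst D)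
            + Real.sqrt D / 2 * (N : ℝ) ^ 3 * Bφ * aliasWtConst D + Bc * (N : ℝ) ^ 3 * (aliasWtConst D / 2))
        + (Real.sqrt D / 2 * ((N : ℝ) ^ 2 / (N : ℝ) ^ D) * ((((N : ℝ) / M) ^ 2) ^ D * aliasWtConst D)
            + Real.sqrt D * N * Bφ / 2 * (N : ℝ) ^ 2 * (((N : ℝ) / M) ^ (D + 1) * aliasWtConst D)
            + Bc * (N : ℝ) ^ 3 * (((N : ℝ) / M) ^ (D + 1) * aliasWtConst D / 2)) := by
  rw [sum_eq_zero_add_sum_erase]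
  refine add_le_add ?_ ?_
  · have h0 := norm_Ahat_fhatF_zero_le hN hq hq0 l y' hφ hc hM hMN κ
    have h1 : ‖readW N M (ofRealVec q) 0 κ x'‖ ≤ 1 := norm_readW_le_one hM q 0 κ x'
    calc ‖readW N M (ofRealVec q) 0 κ x'‖ * ‖Ahat N (ofRealVec q) (fhatF N M (ofRealVec q) l y') 0 0 κ‖
        ≤ 1 * ‖Ahat N (ofRealVec q) (fhatF N M (ofRealVec q) l y') 0 0 κ‖ := mul_le_mul_of_nonneg_right h1 (norm_nonneg _)
      _ ≤ _ := by rw [one_mul]; exact h0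
  · refine (Finset.sum_le_sum fun m _ => mul_le_mul_of_nonneg_left (norm_Ahat_fhatF_le hN hq hq0 l y' hφ hc m κ) (norm_nonneg _)).trans ?_
    exact offZero_readW_alpha_le hN hq hq0 l y' hφ hc hM hMN κ x'

end Generic

/-- The explicit FIELD–FIELD constant `xFF D r` (`r = N/M`; `C = aliasWtConst D`, `bΦ = bPhi0 D r (Dπ²)`, `bC = bC0 D r (Dπ²)`):
`(π/2)^{D+1}·[(√D/2) r^{D+1} C + (√D/2) bΦ C + bC C/2] + (√D/2) r^{2D} C + (√D/2) bΦ r^{D+1} C + bC r^{D+1} C/2`. -/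
def xFF (D : ℕ) (r : ℝ) : ℝ :=
  (π / 2) ^ (D + 1) * (Real.sqrt D / 2 * (r ^ (D + 1) * aliasWtConst D) + Real.sqrt D / 2 * bPhi0 D r (D * π ^ 2) * aliasWtConst D
      + bC0 D r (D * π ^ 2) * (aliasWtConst D / 2))
    + (Real.sqrt D / 2 * ((r ^ 2) ^ D * aliasWtConst D) + Real.sqrt D * bPhi0 D r (D * π ^ 2) / 2 * (r ^ (D + 1) * aliasWtConst D)
      + bC0 D r (D * π ^ 2) * (r ^ (D + 1) * aliasWtConst D / 2))

/-- [folklore] `0 ≤ xFF D r` for `r ≥ 0`. -/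
theorem xFF_nonneg (D : ℕ) {r : ℝ} (hr : 0 ≤ r) : 0 ≤ xFF D r := by
  have := aliasWtConst_nonneg D
  have := bPhi0_nonneg D hr (by positivity : (0 : ℝ) ≤ D * π ^ 2)
  have := bC0_nonneg D hr (by positivity : (0 : ℝ) ≤ D * π ^ 2)
  unfold xFF
  positivity

/-- [folklore] **THE FIELD–FIELD READING SUM WITH THE FEEDBACK INSERTED** (`ForceSourceFeedback.norm_phiSol_fhatF_le'`/`norm_cSol_fhatF_le'`): for every `D`,
`0 < M ≤ N`, `q ∈ [−π, π]^D ∖ {0}`, all `κ l x′ y′`:  `N^D · Σ_m ‖readW(m,κ,x′)‖·‖Â_κ(m)[f̂(l,y′)]‖ ≤ N² · xFF D (N/M)`. -/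
theorem pow_mul_sum_readW_Ahat_le {M : ℕ} (hN : 1 ≤ N) (hM : 0 < M) (hMN : M ≤ N) {q : Fin D → ℝ} (hq : ∀ i, |q i| ≤ π) (hq0 : q ≠ 0)
    (κ l : Fin D) (x' y' : Fin D → ℤ) :
    (N : ℝ) ^ D * ∑ m, ‖readW N M (ofRealVec q) m κ x'‖ * ‖Ahat N (ofRealVec q) (fhatF N M (ofRealVec q) l y') 0 m κ‖
      ≤ (N : ℝ) ^ 2 * xFF D ((N : ℝ) / M) := by
  have hNr : (0 : ℝ) < N := by exact_mod_cast hN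
  have h := sum_readW_Ahat_le_param hN hq hq0 l y' (norm_phiSol_fhatF_le' hN hM hMN hq hq0 l y') (norm_cSol_fhatF_le' hN hM hMN hq hq0 l y')
    hM hMN κ x'
  refine (mul_le_mul_of_nonneg_left h (by positivity)).trans (le_of_eq ?_)
  -- the three unit identities `N^D·(N²/N^D) = N²`, `N^D·N³/N^{D+1} = N²`, `N^D·N·N²/N^{D+1} = N²`
  have hND : (N : ℝ) ^ D ≠ 0 := pow_ne_zero _ hNr.ne'
  have u1 : (N : ℝ) ^ D * ((N : ℝ) ^ 2 / (N : ℝ) ^ D) = (N : ℝ) ^ 2 := by field_simp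
  have u2 : (N : ℝ) ^ D * (N : ℝ) ^ 3 / (N : ℝ) ^ (D + 1) = (N : ℝ) ^ 2 := by
    rw [pow_succ, div_eq_iff (by positivity)]; ring
  set r : ℝ := (N : ℝ) / M
  set bΦ : ℝ := bPhi0 D r (D * π ^ 2)
  set bC : ℝ := bC0 D r (D * π ^ 2)
  set C : ℝ := aliasWtConst D
  unfold xFF
  calc (N : ℝ) ^ D * ((π / 2) ^ (D + 1) * (Real.sqrt D / 2 * ((N : ℝ) ^ 2 / (N : ℝ) ^ D) * (r ^ (D + 1) * C)
            + Real.sqrt D / 2 * (N : ℝ) ^ 3 * (bΦ / (N : ℝ) ^ (D + 1)) * C + bC / (N : ℝ) ^ (D + 1) * (N : ℝ) ^ 3 * (C / 2))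
          + (Real.sqrt D / 2 * ((N : ℝ) ^ 2 / (N : ℝ) ^ D) * ((r ^ 2) ^ D * C)
            + Real.sqrt D * N * (bΦ / (N : ℝ) ^ (D + 1)) / 2 * (N : ℝ) ^ 2 * (r ^ (D + 1) * C)
            + bC / (N : ℝ) ^ (D + 1) * (N : ℝ) ^ 3 * (r ^ (D + 1) * C / 2)))
      = (π / 2) ^ (D + 1) * (Real.sqrt D / 2 * ((N : ℝ) ^ D * ((N : ℝ) ^ 2 / (N : ℝ) ^ D)) * (r ^ (D + 1) * C)
            + Real.sqrt D / 2 * ((N : ℝ) ^ D * (N : ℝ) ^ 3 / (N : ℝ) ^ (D + 1)) * bΦ * C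
            + ((N : ℝ) ^ D * (N : ℝ) ^ 3 / (N : ℝ) ^ (D + 1)) * bC * (C / 2))
          + (Real.sqrt D / 2 * ((N : ℝ) ^ D * ((N : ℝ) ^ 2 / (N : ℝ) ^ D)) * ((r ^ 2) ^ D * C)
            + Real.sqrt D * bΦ / 2 * ((N : ℝ) ^ D * (N : ℝ) ^ 3 / (N : ℝ) ^ (D + 1)) * (r ^ (D + 1) * C)
            + ((N : ℝ) ^ D * (N : ℝ) ^ 3 / (N : ℝ) ^ (D + 1)) * bC * (r ^ (D + 1) * C / 2)) := by ring
    _ = (N : ℝ) ^ 2 * ((π / 2) ^ (D + 1) * (Real.sqrt D / 2 * (r ^ (D + 1) * C) + Real.sqrt D / 2 * bΦ * C + bC * (C / 2))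
          + (Real.sqrt D / 2 * ((r ^ 2) ^ D * C) + Real.sqrt D * bΦ / 2 * (r ^ (D + 1) * C) + bC * (r ^ (D + 1) * C / 2))) := by
        rw [u1, u2]; ring

/-! ## §6 H1 at `d = 3`: the units `s_f(j)² = M²` close exactly at `D = 4` -/

/-- [folklore] **H1 `ScaledFF` AT `d = 3`** (`D = 4`, `N = Lc^{j+1}`, `M = Lc^j`, `s_f(j) = sfStep Lc j = Lc^j`): for every step `j`, every `q ∈ [−π,π]⁴ ∖ {0}` and all
`κ l x′ y′`:  `sfStep Lc j ^ 2 · Σ_m ‖readW(m,κ,x′)‖·‖Â_κ(m)[f̂(l,y′)]‖ ≤ xFF 4 Lc / Lc²` — N-FREE.  This is the body of leaf-05's hypothesis shape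
`FibreUniformBound.ScaledFF (d := 3) Lc (sfStep Lc) (xFF 4 Lc / Lc²)` (row P1-L09, `FibreUniformBoundOfParts`); its `q ∈ BZ 4` binder converts by `abs_le`. -/
theorem scaledFF_three (Lc : ℕ) [NeZero Lc] (j : ℕ) {q : Fin (3 + 1) → ℝ} (hq : ∀ i, |q i| ≤ π) (hq0 : q ≠ 0)
    (κ l : Fin (3 + 1)) (x' y' : Fin (3 + 1) → ℤ) :
    sfStep Lc j ^ 2 * ∑ m : TorusSite (3 + 1) (Lc ^ (j + 1)), ‖readW (Lc ^ (j + 1)) (Lc ^ j) (ofRealVec q) m κ x'‖ *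
        ‖Ahat (Lc ^ (j + 1)) (ofRealVec q) (fhatF (Lc ^ (j + 1)) (Lc ^ j) (ofRealVec q) l y') 0 m κ‖
      ≤ xFF 4 Lc / (Lc : ℝ) ^ 2 := by
  have hLc : 0 < Lc := Nat.pos_of_ne_zero (NeZero.ne Lc)
  have hLcr : (0 : ℝ) < Lc := by exact_mod_cast hLc
  have hN : 1 ≤ Lc ^ (j + 1) := Nat.one_le_pow _ _ hLc
  have hM : 0 < Lc ^ j := pow_pos hLc j
  have hMN : Lc ^ j ≤ Lc ^ (j + 1) := Nat.pow_le_pow_right hLc (Nat.le_succ j)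
  have h := pow_mul_sum_readW_Ahat_le (D := 3 + 1) hN hM hMN hq hq0 κ l x' y'
  have hr : ((Lc ^ (j + 1) : ℕ) : ℝ) / ((Lc ^ j : ℕ) : ℝ) = Lc := by
    push_cast
    rw [pow_succ]
    field_simp
  rw [hr] at h
  set S := ∑ m : TorusSite (3 + 1) (Lc ^ (j + 1)), ‖readW (Lc ^ (j + 1)) (Lc ^ j) (ofRealVec q) m κ x'‖ *
        ‖Ahat (Lc ^ (j + 1)) (ofRealVec q) (fhatF (Lc ^ (j + 1)) (Lc ^ j) (ofRealVec q) l y') 0 m κ‖ with hS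
  have hNpos : (0 : ℝ) < ((Lc ^ (j + 1) : ℕ) : ℝ) := by positivity
  -- `N²·S ≤ xFF`
  have hS1 : ((Lc ^ (j + 1) : ℕ) : ℝ) ^ 2 * S ≤ xFF 4 Lc := by
    have h' : ((Lc ^ (j + 1) : ℕ) : ℝ) ^ 2 * (((Lc ^ (j + 1) : ℕ) : ℝ) ^ 2 * S) ≤ ((Lc ^ (j + 1) : ℕ) : ℝ) ^ 2 * xFF 4 Lc := by
      have e4 : ((Lc ^ (j + 1) : ℕ) : ℝ) ^ (3 + 1) * S = ((Lc ^ (j + 1) : ℕ) : ℝ) ^ 2 * (((Lc ^ (j + 1) : ℕ) : ℝ) ^ 2 * S) := by ring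
      rw [e4] at h
      exact h
    exact le_of_mul_le_mul_left h' (by positivity)
  replace hS1 : S ≤ xFF 4 Lc / ((Lc ^ (j + 1) : ℕ) : ℝ) ^ 2 := by
    rw [le_div_iff₀ (by positivity), mul_comm]; exact hS1
  have e : sfStep Lc j ^ 2 * (xFF 4 Lc / ((Lc ^ (j + 1) : ℕ) : ℝ) ^ 2) = xFF 4 Lc / (Lc : ℝ) ^ 2 := by
    unfold sfStep
    push_cast
    field_simp
    ring
  calc sfStep Lc j ^ 2 * S ≤ sfStep Lc j ^ 2 * (xFF 4 Lc / ((Lc ^ (j + 1) : ℕ) : ℝ) ^ 2) := mul_le_mul_of_nonneg_left hS1 (sq_nonneg _)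
    _ = xFF 4 Lc / (Lc : ℝ) ^ 2 := e

/-- [folklore] The same with the zone hypothesis in `B4ContourShift.BZ` form (`q ∈ BZ (3+1) = [−π, π]⁴`, `q ≠ 0`) — binder for binder the body of
`FibreUniformBound.ScaledFF (d := 3) Lc (sfStep Lc) (xFF 4 Lc / Lc²)`, so the L09 assembly's `h₁` is `fun j q hq hq0 κ l x' y' => scaledFF_three_of_mem_BZ Lc j hq hq0 κ l x' y'`. -/
theorem scaledFF_three_of_mem_BZ (Lc : ℕ) [NeZero Lc] (j : ℕ) {q : Fin (3 + 1) → ℝ} (hq : q ∈ BZ (3 + 1)) (hq0 : q ≠ 0)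
    (κ l : Fin (3 + 1)) (x' y' : Fin (3 + 1) → ℤ) :
    sfStep Lc j ^ 2 * ∑ m : TorusSite (3 + 1) (Lc ^ (j + 1)), ‖readW (Lc ^ (j + 1)) (Lc ^ j) (ofRealVec q) m κ x'‖ *
        ‖Ahat (Lc ^ (j + 1)) (ofRealVec q) (fhatF (Lc ^ (j + 1)) (Lc ^ j) (ofRealVec q) l y') 0 m κ‖
      ≤ xFF 4 Lc / (Lc : ℝ) ^ 2 :=
  scaledFF_three Lc j (fun i => abs_le.2 ⟨hq.1 i, hq.2 i⟩) hq0 κ l x' y'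

end Summit.QuantumFields.BalabanUV.Beta.GAN24.ScaledPartFF

end
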